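import Summits.ABC.IUTFork.DAGC312p
import Summits.ABC.IUTFork.Cor312TeamAHonestCensus
import Summits.ABC.IUTFork.Cor312IdentifiedChain
import Summits.ABC.IUTFork.Cor312StepContents
import HarnessLib

/-!
# [IUTchIII] Cor. 3.12, proof step (iii) — the kernel DAG node `N_IUTchIII_Cor3_12_pf_iii` SOLVED FOR ITS
# CONTENT and RE-CLOSED against every typed reading (FACT-LIST row F-2156; zero FACT binders)

S. Mochizuki, *Inter-universal Teichmüller theory III*, kurims `.tex` p. 176 l. 18–33 [Mochizuki2012, Cor. 3.12,
proof, step (iii); claim key, status disputed]: "the non-commutativity of the log-theta-lattice renders it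
practically impossible to obtain conclusions that require one to relate both the unit and the value group portions
simultaneously [via different links] … This is precisely why we concentrate on a single Θ^{×μ}_{LGP}-link"
(observation `Obs.singleLinkNecessary`), citing Rmk 3.11.3 (locus `Locus.rem3_11_3`) and referring back to step (i).

PROOF-ONLY companion (no definition, no instance, no named fact; abc-iut cell, seat abc-iut-L1-d1 gen 11, keyed
row F-2156) of the index node `Summit.ABC.IUTFork.DAG.N_IUTchIII_Cor3_12_pf_iii pending O :=
Cor312Proof.Step.iii.Holds (locusNode pending) O` (`DAGC312b.lean`; data `Step.iii.data = ⟨3, [rem3_11_3], [i], [],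
[singleLinkNecessary]⟩` in `Cor312Steps.lean`). The node is PARAMETRISED by two readings — `pending : Locus → Prop`
(which cited loci one grants) and `O : Obs → Prop` (which of the proof's own observations one grants) — so the
FACT-LIST census asks what its closers bind. This file answers in the kernel, BY NAME:

* §1 SOLVED FOR ITS CONTENT: `N_IUTchIII_Cor3_12_pf_iii_iff` — the node is EXACTLY the implication
  `pending .rem3_11_3 → O .singleLinkNecessary` ("granting Rmk 3.11.3, observation (iii) is granted"); hence the
  minimal conditional closer `…_holds_of` (its one hypothesis is necessary and sufficient — the RESIDUAL of the row
  is the node's own inference, nothing upstream), the two zero-binder partial closures `…_holds_of_obs` /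
  `…_holds_of_not_rem3_11_3`, and the failure locus `not_N_IUTchIII_Cor3_12_pf_iii_iff`.
* §2 THE CLOSURES, DECIDED: over observation readings the node closes iff the loci reading DENIES Rmk 3.11.3
  (`forall_obs_…_iff`); over loci readings iff the observation reading GRANTS (iii)'s observation
  (`forall_loci_…_iff`); the universal closure over both is REFUTED by the reading that grants every locus and
  every observation except (iii)'s own (`…_not_automatic`, `not_forall_…`) — the schema is not a theorem, its
  instance forms are the content — and is satisfiable (`…_holds_grant`).
* §3 ZERO-BINDER INSTANCES AT EVERY OBSERVATION READING THE TREE HAS TYPED, for EVERY loci reading: the index's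
  reading of record `DAG.obsReadingA` (part p's `N_IUTchIII_Cor3_12_pf_iii_holds` is the diagonal case; here for an
  arbitrary loci parameter, since the record reads (iii) as the value of the NOTED locus Rmk 3.11.3, which is `True`:
  `lociReadingI_rem3_11_3`), the Scholze–Stix identified-copies reading `Cor312.Setting.identifiedObs`
  ([ScholzeStix2018] §2.2: (iii) is uncontested machinery, a `True` arm), TEAM A's `Cor312Proof.honestReading` and
  the pre-(x) overlay `Cor312Vol.PreX.OPreX` (narrative arms `True`); and the two overlays that DEFER (iii) to their
  base (`Cor312.Setting.realReadingXIde`, `Cor312Proof.OStepX`) reduce to the base (`…_iff_base`).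

HONEST FRAMING. A step node is an INFERENCE of a disputed text under explicit readings; "re-closed" = OUR kernel
theorems about that inference with no assumption-class binder. Step (iii) is methodological prose (why ONE link):
under every typed reading it is granted or passes the NOTED locus through, and the kernel content is exactly §1.
Nothing here bears on the disputed node (xi-f), takes a side on [IUTchIII] Cor. 3.12 or on any author, or asserts
that abc is proved or refuted; typed ≠ proved; indexed ≠ endorsed. [claim: Mochizuki2012, status: disputed]
-/

namespace Summit.ABC.IUTFork.DAG

open Cor312Proof Thm311 Literature.IUT.LogThetaLattice

section Content

variable (pending : Locus → Prop) (O : Obs → Prop)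

/-! ## §1 The node solved for its content -/

/-- **Step (iii) SOLVED FOR ITS CONTENT**: the index node under the readings `(pending, O)` is exactly
"Rmk 3.11.3 granted ⟹ observation (iii) granted". [claim: Mochizuki2012, status: disputed] -/
theorem N_IUTchIII_Cor3_12_pf_iii_iff :
    N_IUTchIII_Cor3_12_pf_iii pending O ↔ (pending .rem3_11_3 → O .singleLinkNecessary) := by
  constructor
  · intro h hc
    refine h (fun c hc' => ?_) (fun o ho => ?_) _ (by decide)
    · have : c = .rem3_11_3 := by simpa [Step.cites, Step.data] using hc'
      subst this
      exact hc
    · simp [Step.uses, Step.data] at ho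
  · intro h hc _ o ho
    have : o = .singleLinkNecessary := by simpa [Step.concl, Step.data] using ho
    subst this
    exact h (hc _ (by decide))

/-- The MINIMAL CONDITIONAL CLOSER: one hypothesis, the node's own inference (necessary and sufficient by
`N_IUTchIII_Cor3_12_pf_iii_iff` — the residual of the row is this implication and nothing upstream). [folklore] -/
theorem N_IUTchIII_Cor3_12_pf_iii_holds_of (h : pending .rem3_11_3 → O .singleLinkNecessary) :
    N_IUTchIII_Cor3_12_pf_iii pending O :=
  (N_IUTchIII_Cor3_12_pf_iii_iff pending O).2 h

/-- Zero-binder partial closure (a): under ANY loci reading, the node holds at every observation reading that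
grants observation (iii) (TEAM A's `Cor312Proof.iii_holds_of`, by name). [folklore] -/
theorem N_IUTchIII_Cor3_12_pf_iii_holds_of_obs (h : O .singleLinkNecessary) :
    N_IUTchIII_Cor3_12_pf_iii pending O :=
  iii_holds_of (L := locusNode pending) h

/-- Zero-binder partial closure (b): under ANY observation reading, the node holds (vacuously) at every loci
reading that denies the one cited locus Rmk 3.11.3. [folklore] -/
theorem N_IUTchIII_Cor3_12_pf_iii_holds_of_not_rem3_11_3 (h : ¬ pending .rem3_11_3) :
    N_IUTchIII_Cor3_12_pf_iii pending O :=
  N_IUTchIII_Cor3_12_pf_iii_holds_of pending O fun hc => absurd hc h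

/-- THE FAILURE LOCUS: the node fails exactly at the readings granting Rmk 3.11.3 and denying observation (iii).
[folklore] -/
theorem not_N_IUTchIII_Cor3_12_pf_iii_iff :
    ¬ N_IUTchIII_Cor3_12_pf_iii pending O ↔ pending .rem3_11_3 ∧ ¬ O .singleLinkNecessary := by
  rw [N_IUTchIII_Cor3_12_pf_iii_iff, Classical.not_imp]

/-! ## §2 The closures, decided -/

/-- CLOSURE OVER OBSERVATION READINGS: for a fixed loci reading the node holds under EVERY observation reading iff
the loci reading denies Rmk 3.11.3. [folklore] -/
theorem forall_obs_N_IUTchIII_Cor3_12_pf_iii_iff :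
    (∀ O' : Obs → Prop, N_IUTchIII_Cor3_12_pf_iii pending O') ↔ ¬ pending .rem3_11_3 :=
  ⟨fun h hc => (N_IUTchIII_Cor3_12_pf_iii_iff pending (fun _ => False)).1 (h _) hc,
    fun h O' => N_IUTchIII_Cor3_12_pf_iii_holds_of_not_rem3_11_3 pending O' h⟩

/-- CLOSURE OVER LOCI READINGS: for a fixed observation reading the node holds under EVERY loci reading iff the
observation reading grants observation (iii). [folklore] -/
theorem forall_loci_N_IUTchIII_Cor3_12_pf_iii_iff :
    (∀ pending' : Locus → Prop, N_IUTchIII_Cor3_12_pf_iii pending' O) ↔ O .singleLinkNecessary :=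
  ⟨fun h => (N_IUTchIII_Cor3_12_pf_iii_iff (fun _ => True) O).1 (h _) trivial,
    fun h pending' => N_IUTchIII_Cor3_12_pf_iii_holds_of_obs pending' O h⟩

/-- **NOT AUTOMATIC** (the universal closure's refuting instance): granting every locus and every observation of the
proof EXCEPT (iii)'s own `singleLinkNecessary` violates node (iii). [folklore] -/
theorem N_IUTchIII_Cor3_12_pf_iii_not_automatic :
    ¬ N_IUTchIII_Cor3_12_pf_iii (fun _ => True) (fun o => o ≠ .singleLinkNecessary) :=
  fun h => (N_IUTchIII_Cor3_12_pf_iii_iff _ _).1 h trivial rfl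

/-- **THE UNIVERSAL CLOSURE OVER BOTH READINGS IS REFUTED** — the schema `∀ pending O, N_IUTchIII_Cor3_12_pf_iii
pending O` is not a theorem; its instance forms (§§1, 3) are the content. [folklore] -/
theorem not_forall_N_IUTchIII_Cor3_12_pf_iii :
    ¬ ∀ (pending' : Locus → Prop) (O' : Obs → Prop), N_IUTchIII_Cor3_12_pf_iii pending' O' :=
  fun h => N_IUTchIII_Cor3_12_pf_iii_not_automatic (h _ _)

/-- SATISFIABLE: granting every observation, the node holds under any loci reading. [folklore] -/
theorem N_IUTchIII_Cor3_12_pf_iii_holds_grant : N_IUTchIII_Cor3_12_pf_iii pending fun _ => True :=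
  N_IUTchIII_Cor3_12_pf_iii_holds_of_obs pending _ trivial

/-- The universal closure over observation readings FAILS at every loci reading granting Rmk 3.11.3 — in
particular at the all-granting one. [folklore] -/
theorem not_forall_obs_N_IUTchIII_Cor3_12_pf_iii_grant :
    ¬ ∀ O' : Obs → Prop, N_IUTchIII_Cor3_12_pf_iii (fun _ => True) O' :=
  fun h => (forall_obs_N_IUTchIII_Cor3_12_pf_iii_iff _).1 h trivial

end Content

/-! ## §3 Zero-binder instances at every observation reading the tree has typed -/

section Record

variable {T : ThetaIndex} (S : FullSituation T) (pending pending' : Locus → Prop)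
  (P : Cor312.Setting S.toSituation) (D : ThetaLinkStrips P.LogLink P.Strip) (O : Obs → Prop)

/-- At the index's LOCI READING OF RECORD the one cited locus, Rmk 3.11.3 (NOTED: interpretive prose, no decl —
part l), is granted outright. [folklore] -/
theorem lociReadingI_rem3_11_3 : lociReadingI S pending .rem3_11_3 := trivial

/-- Hence under the loci reading of record the node, for ANY observation reading, is exactly "observation (iii) is
granted". [folklore] -/
theorem N_IUTchIII_Cor3_12_pf_iii_lociReadingI_iff :
    N_IUTchIII_Cor3_12_pf_iii (lociReadingI S pending) O ↔ O .singleLinkNecessary := by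
  rw [N_IUTchIII_Cor3_12_pf_iii_iff]
  exact ⟨fun h => h (lociReadingI_rem3_11_3 S pending), fun h _ => h⟩

/-- **READING OF RECORD, every loci parameter**: the index's observation reading of record `obsReadingA` reads (iii)
as the value of its cited locus at the record, which is `True`; so the node holds at `obsReadingA S pending P D`
under EVERY loci reading `pending'` (part p's `N_IUTchIII_Cor3_12_pf_iii_holds` is the diagonal
`pending' = lociReadingI S pending`). [folklore] -/
theorem N_IUTchIII_Cor3_12_pf_iii_holds_obsReadingA :
    N_IUTchIII_Cor3_12_pf_iii pending' (obsReadingA S pending P D) :=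
  N_IUTchIII_Cor3_12_pf_iii_holds_of_obs pending' _ (lociReadingI_rem3_11_3 S pending)

/-- The diagonal case IS part p's closer (proof irrelevance records the agreement by name). [folklore] -/
theorem N_IUTchIII_Cor3_12_pf_iii_holds_obsReadingA_record :
    N_IUTchIII_Cor3_12_pf_iii (lociReadingI S pending) (obsReadingA S pending P D) :=
  N_IUTchIII_Cor3_12_pf_iii_holds S pending P D

end Record

section Readings

variable {T : ThetaIndex} {S : Situation T} (pending : Locus → Prop) (P : Cor312.Setting S)

/-- **SCHOLZE–STIX IDENTIFIED-COPIES READING** ([ScholzeStix2018] §2.2 pp. 9–10, `Cor312.Setting.identifiedObs`):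
(iii) is uncontested machinery there (a `True` arm), so the node holds under every loci reading, zero binders.
[folklore] -/
theorem N_IUTchIII_Cor3_12_pf_iii_holds_identifiedObs :
    N_IUTchIII_Cor3_12_pf_iii pending P.identifiedObs :=
  N_IUTchIII_Cor3_12_pf_iii_holds_of_obs pending _ trivial

/-- **TEAM A's HONEST READING** (`Cor312Proof.honestReading`, row A-5: (iii) is narrative at this typing level, a
`True` arm): the node holds under every loci reading, for every column, strips datum, loci parameter and strip
algorithm, zero binders. [folklore] -/
theorem N_IUTchIII_Cor3_12_pf_iii_holds_honestReading (C : Column S.L) (D : ThetaLinkStrips P.LogLink P.Strip)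
    (L : Locus → Prop) (A : InputStrip.StripAlgorithm P) :
    N_IUTchIII_Cor3_12_pf_iii pending (honestReading P C D L A) :=
  N_IUTchIII_Cor3_12_pf_iii_holds_of_obs pending _ trivial

/-- **THE PRE-(x) OVERLAY** (`Cor312Vol.PreX.OPreX`, (iii) ↦ `True`): the node holds under every loci reading and
over every base reading, zero binders. [folklore] -/
theorem N_IUTchIII_Cor3_12_pf_iii_holds_OPreX (base : Obs → Prop) :
    N_IUTchIII_Cor3_12_pf_iii pending (Cor312Vol.PreX.OPreX P base) :=
  N_IUTchIII_Cor3_12_pf_iii_holds_of_obs pending _ trivial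

/-- The (xi-d)/(xi-e) overlay `Cor312.Setting.realReadingXIde` DEFERS (iii) to its base: the node there is the
node at the base. [folklore] -/
theorem N_IUTchIII_Cor3_12_pf_iii_realReadingXIde_iff_base (O₀ : Obs → Prop) :
    N_IUTchIII_Cor3_12_pf_iii pending (P.realReadingXIde O₀) ↔ N_IUTchIII_Cor3_12_pf_iii pending O₀ := by
  rw [N_IUTchIII_Cor3_12_pf_iii_iff, N_IUTchIII_Cor3_12_pf_iii_iff]
  exact Iff.rfl

/-- The step-(x) overlay `Cor312Proof.OStepX` DEFERS (iii) to its base likewise. [folklore] -/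
theorem N_IUTchIII_Cor3_12_pf_iii_OStepX_iff_base (C : Column S.L) (base : Obs → Prop) :
    N_IUTchIII_Cor3_12_pf_iii pending (OStepX P C base) ↔ N_IUTchIII_Cor3_12_pf_iii pending base := by
  rw [N_IUTchIII_Cor3_12_pf_iii_iff, N_IUTchIII_Cor3_12_pf_iii_iff]
  exact Iff.rfl

end Readings

/-- CENSUS OF THE ROW (kernel bookkeeping by `decide` over the landed citation data): node (iii) cites exactly one
locus, invokes no earlier observation, draws exactly one observation — so its content is one implication (§1) and
its universal closure has exactly the one refuting pattern of §2. [folklore] -/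
theorem N_IUTchIII_Cor3_12_pf_iii_census :
    Step.iii.cites = [.rem3_11_3] ∧ Step.iii.uses = [] ∧ Step.iii.concl = [.singleLinkNecessary] ∧
      Step.iii.after = [.i] := by
  decide

end Summit.ABC.IUTFork.DAG
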